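/- Copyright: ym3-torus cell, WIDTH seat `ym-ust-19936-w7` (prover, g9), for crux `HistoryTailL` (stmt-QuantumFields-19936),
level-0 prefactor-free infrastructure (T1, Gaussian form) of LINE `local_insertion` (#13) ∕ K1.  Released under the licence of the surrounding project. -/
import Summits.QuantumFields.YangMills.Theorems.LocalInsertionTorusTreeGaugeLowerBound
import Literature.MathematicalPhysics.QuantumFieldTheory.AbelianVortexClustering
import Literature.Barriers.QuantumFields.ToronPlaneAnticorrelation
import HarnessLib

/-!
# The tree-gauge lower bound in Gaussian form: `Z_{Λ_L}(β) ≥ e^{−8N d² L^d}·(c·(1+β)^{−D/2})^{(d−1)L^d+1}`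

Support file (`--supports stmt-QuantumFields-19936 --as helper`), companion of ✓`…Theorems.LocalInsertionTorusTreeGaugeLowerBound`
(`TorusTreeGauge.lintegral_boltzmann_ge_treeGauge`, the tree-gauge lower bound with a free radius `r` and ball mass `cb`): here the
radius is the Gaussian one, `r = (1+β)^{−1/2}` (`βr² ≤ 1`, so the Boltzmann factor on the event costs only `e^{−8N·#plaquettes}`), and
`cb = c·r^D` is the tree's small-ball lower bound — ✓`HaarSmallBallClosedSubgroup.haar_ball_ge_of_unitaryRep` (every compact `G`,
`D = dim_ℝ 𝔤(ρ(G))`, soft `c`) and ✓`haar_ball_ge_specialUnitaryGroup` (`G = SU(N)`, `D = N² − 1`).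

* §1 ★ `exists_lintegral_boltzmann_ge_treeGauge_gaussian` — every compact second countable `G`, continuous unitary `ρ`;
* §2 ★★ `exists_lintegral_boltzmann_ge_treeGauge_SU` — `G = SU(N)`, `ρ = QuantumLattice.fundamentalRep (Fin N)` (the letters of
  ✓`T3FinestHeightTail.gibbsMeasure_real_eq_wilsonMeasure_real` and of ★w4-19936 g10's T2 files ✓p681391 ∕ p681608): for `d = 3`, `N = 2`
  the `zlow` of the door ✓`PlaquetteExpMoment.integral_exp_mul_plaquette_le_of_sandwich` reads `e^{−144L³}·(c·(1+β)^{−3/2})^{2L³+1}`.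

HONEST SCOPE.  Corollaries (radius bookkeeping) of the tree-gauge lower bound; [Chatterjee2016] Thm 2.1 lower half ∕ Lemma 17.6,
[Balaban1987RG1] (0.15).  Nothing of LINE #13's stubs, of `HistoryTailL`, of any crux is proved; the residual `β^{c/L}` of the sandwich
is not coupling-uniform at fixed small volume (LEAD caveat) — nothing here is worded as a stub.  YM₃ on T³ is rung R3 — not d = 4, not
infinite volume, not a mass gap, not Clay.  THEOREMS ONLY (0 `def`, 0 `sorry`); count-neutral.
-/

noncomputable section

open MeasureTheory Finset Function
open scoped ENNReal Matrix.Norms.L2Operator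

namespace Summit.QuantumFields.YangMills.Theorems.LocalInsertion.TorusTreeGauge

open Literature.MathematicalPhysics.QuantumFieldTheory

/-! ## §1 The Gaussian form: `r = (1+β)^{−1/2}` and the small-ball bound `Haar{‖ρ g − 1‖ ≤ r} ≥ c·r^{dim 𝔤}` -/

section Gaussian

variable {d L m : ℕ} [NeZero d] [NeZero L] [Fact (1 < L)] [NeZero m]
variable {G : Type*} [Group G] [TopologicalSpace G] [IsTopologicalGroup G] [CompactSpace G]
  [MeasurableSpace G] [BorelSpace G] [SecondCountableTopology G]

variable (ρ : G →* Matrix (Fin m) (Fin m) ℂ) (hρu : ∀ g, ρ g ∈ Matrix.unitaryGroup (Fin m) ℂ)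

include hρu in
/-- ★ **THE TREE-GAUGE LOWER BOUND, GAUSSIAN FORM, EVERY COMPACT `G` (soft small-ball constant).**  With
`D = dim_ℝ 𝔤(ρ(G))` (`QuantumLattice.matrixLieAlgebra (range ρ)`, the exponent of the tree's small-ball bound
✓`HaarSmallBallClosedSubgroup.haar_ball_ge_of_unitaryRep`) there is `c ∈ (0,1]` with, for every `L ≥ 2` and `β ≥ 0`,
`∫ e^{−βS} dπ ≥ e^{−8N d² L^d} · (c · (√(1+β))⁻¹^D)^{(d−1)L^d + 1}` (`r = (1+β)^{−1/2}`, `βr² ≤ 1`).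
[cite: Chatterjee2016, Lemma 17.6; Balaban1987RG1, (0.15) p.254] -/
theorem exists_lintegral_boltzmann_ge_treeGauge_gaussian (hρc : Continuous ρ) :
    ∃ c : ℝ, 0 < c ∧ c ≤ 1 ∧ ∀ (L : ℕ) [NeZero L] [Fact (1 < L)] (β : ℝ), 0 ≤ β →
      ENNReal.ofReal (Real.exp (-(8 * (m : ℝ) * d ^ 2 * (L : ℝ) ^ d)) *
          (c * (Real.sqrt (1 + β))⁻¹ ^ Module.finrank ℝ
              (Literature.MathematicalPhysics.QuantumLattice.matrixLieAlgebra (Set.range ρ))) ^ ((d - 1) * L ^ d + 1)) ≤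
        ∫⁻ U, ENNReal.ofReal (Real.exp (-β * wilsonAction ρ U)) ∂(Measure.pi fun _ : Edge d L => haarProbability G) := by
  obtain ⟨c, hc, hc1, hball⟩ :=
    Balaban1983to89.HaarSmallBallClosedSubgroup.haar_ball_ge_of_unitaryRep ρ hρc hρu (R := 1) one_pos
  refine ⟨c, hc, hc1, fun L _ _ β hβ => ?_⟩
  set D : ℕ := Module.finrank ℝ (Literature.MathematicalPhysics.QuantumLattice.matrixLieAlgebra (Set.range ρ)) with hD
  -- the radius `r = 1/√(1+β)`
  set s : ℝ := Real.sqrt (1 + β) with hs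
  have hs1 : 1 ≤ s := by rw [hs]; exact Real.one_le_sqrt.mpr (by linarith)
  have hs0 : 0 < s := one_pos.trans_le hs1
  set r : ℝ := s⁻¹ with hr
  have hr0 : 0 < r := inv_pos.mpr hs0
  have hr1 : r ≤ 1 := inv_le_one_of_one_le₀ hs1
  have hβr : β * r ^ 2 ≤ 1 := by
    rw [hr, inv_pow, hs, Real.sq_sqrt (by linarith), mul_inv_le_iff₀ (by linarith)]
    linarith
  haveI : (haarProbability G).IsMulLeftInvariant := by unfold haarProbability; infer_instance
  have hb := hball (haarProbability G) r hr0 hr1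
  have hcb : 0 < c * r ^ D := mul_pos hc (pow_pos hr0 _)
  have key := lintegral_boltzmann_ge_treeGauge (d := d) (L := L) ρ hρu hρc hβ hr0.le hcb hb
  rw [card_filter_not_torusComb] at key
  refine le_trans (ENNReal.ofReal_le_ofReal ?_) key
  have hexp : Real.exp (-(8 * (m : ℝ) * d ^ 2 * (L : ℝ) ^ d)) ≤
      Real.exp (-(β * ((Fintype.card (Plaquette d L) : ℝ) * (8 * m * r ^ 2)))) := by
    refine Real.exp_le_exp.mpr (neg_le_neg ?_)
    have hP : (Fintype.card (Plaquette d L) : ℝ) ≤ d ^ 2 * (L : ℝ) ^ d := by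
      exact_mod_cast LatticeForm.card_plaquette_le (d := d) (L := L)
    calc β * ((Fintype.card (Plaquette d L) : ℝ) * (8 * m * r ^ 2))
        = (β * r ^ 2) * (8 * m) * Fintype.card (Plaquette d L) := by ring
      _ ≤ 1 * (8 * m) * (d ^ 2 * (L : ℝ) ^ d) := by gcongr
      _ = 8 * (m : ℝ) * d ^ 2 * (L : ℝ) ^ d := by ring
  exact mul_le_mul_of_nonneg_right hexp (pow_nonneg hcb.le _)

end Gaussian

/-! ## §2 `G = SU(N)`, fundamental representation: the exponent `N² − 1` -/

section SpecialUnitary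

open Literature.MathematicalPhysics.QuantumLattice (fundamentalRep continuous_fundamentalRep fundamentalRep_mem_unitaryGroup)
open Balaban1983to89.HaarSmallBallClosedSubgroup (haar_ball_ge_specialUnitaryGroup)

variable {d N : ℕ} [NeZero d] [NeZero N]

/-- ★★ **THE TREE-GAUGE LOWER BOUND FOR `SU(N)` (fundamental Wilson action), GAUSSIAN FORM.**  There is `c = c(N) ∈ (0,1]` with,
on every torus `(ℤ/Lℤ)^d` (`L ≥ 2`, `d ≥ 1`) and for every `β ≥ 0`,
`∫ e^{−βS} dπ ≥ e^{−8N d² L^d} · (c · (√(1+β))⁻¹^{N²−1})^{(d−1)L^d + 1}` — the `zlow` letter of the door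
✓`PlaquetteExpMoment.integral_exp_mul_plaquette_le_of_sandwich` with the sharp Gaussian count; for `d = 3`, `N = 2`:
`e^{−144 L³}·(c(1+β)^{−3/2})^{2L³+1}`. [cite: Chatterjee2016, Thm. 2.1 (lower half), Lemma 17.6; Balaban1987RG1, (0.15) p.254] -/
theorem exists_lintegral_boltzmann_ge_treeGauge_SU :
    ∃ c : ℝ, 0 < c ∧ c ≤ 1 ∧ ∀ (L : ℕ) [NeZero L] [Fact (1 < L)] (β : ℝ), 0 ≤ β →
      ENNReal.ofReal (Real.exp (-(8 * (N : ℝ) * d ^ 2 * (L : ℝ) ^ d)) *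
          (c * (Real.sqrt (1 + β))⁻¹ ^ (N ^ 2 - 1)) ^ ((d - 1) * L ^ d + 1)) ≤
        ∫⁻ U, ENNReal.ofReal (Real.exp (-β * wilsonAction (fundamentalRep (Fin N)) U))
          ∂(Measure.pi fun _ : Edge d L => haarProbability (Matrix.specialUnitaryGroup (Fin N) ℂ)) := by
  haveI := Literature.Barriers.QuantumFields.secondCountableTopology_su N
  obtain ⟨c, hc, hc1, hball⟩ := haar_ball_ge_specialUnitaryGroup (n := Fin N) (R := 1) one_pos
  refine ⟨c, hc, hc1, fun L _ _ β hβ => ?_⟩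
  set s : ℝ := Real.sqrt (1 + β) with hs
  have hs1 : 1 ≤ s := by rw [hs]; exact Real.one_le_sqrt.mpr (by linarith)
  have hs0 : 0 < s := one_pos.trans_le hs1
  set r : ℝ := s⁻¹ with hr
  have hr0 : 0 < r := inv_pos.mpr hs0
  have hr1 : r ≤ 1 := inv_le_one_of_one_le₀ hs1
  have hβr : β * r ^ 2 ≤ 1 := by
    rw [hr, inv_pow, hs, Real.sq_sqrt (by linarith), mul_inv_le_iff₀ (by linarith)]
    linarith
  haveI : (haarProbability (Matrix.specialUnitaryGroup (Fin N) ℂ)).IsMulLeftInvariant := by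
    unfold haarProbability; infer_instance
  have hb := hball (haarProbability (Matrix.specialUnitaryGroup (Fin N) ℂ)) r hr0 hr1
  rw [Fintype.card_fin] at hb
  have hcb : 0 < c * r ^ (N ^ 2 - 1) := mul_pos hc (pow_pos hr0 _)
  have hball' : ENNReal.ofReal (c * r ^ (N ^ 2 - 1)) ≤
      haarProbability (Matrix.specialUnitaryGroup (Fin N) ℂ) {g | ‖fundamentalRep (Fin N) g - 1‖ ≤ r} := by
    simpa only [Literature.MathematicalPhysics.QuantumLattice.fundamentalRep_apply] using hb
  have key := lintegral_boltzmann_ge_treeGauge (d := d) (L := L) (fundamentalRep (Fin N)) fundamentalRep_mem_unitaryGroup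
    (continuous_fundamentalRep (Fin N)) hβ hr0.le hcb hball'
  rw [card_filter_not_torusComb] at key
  refine le_trans (ENNReal.ofReal_le_ofReal ?_) key
  have hexp : Real.exp (-(8 * (N : ℝ) * d ^ 2 * (L : ℝ) ^ d)) ≤
      Real.exp (-(β * ((Fintype.card (Plaquette d L) : ℝ) * (8 * N * r ^ 2)))) := by
    refine Real.exp_le_exp.mpr (neg_le_neg ?_)
    have hP : (Fintype.card (Plaquette d L) : ℝ) ≤ d ^ 2 * (L : ℝ) ^ d := by
      exact_mod_cast LatticeForm.card_plaquette_le (d := d) (L := L)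
    calc β * ((Fintype.card (Plaquette d L) : ℝ) * (8 * N * r ^ 2))
        = (β * r ^ 2) * (8 * N) * Fintype.card (Plaquette d L) := by ring
      _ ≤ 1 * (8 * N) * (d ^ 2 * (L : ℝ) ^ d) := by gcongr
      _ = 8 * (N : ℝ) * d ^ 2 * (L : ℝ) ^ d := by ring
  exact mul_le_mul_of_nonneg_right hexp (pow_nonneg hcb.le _)

end SpecialUnitary

end Summit.QuantumFields.YangMills.Theorems.LocalInsertion.TorusTreeGauge

end
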